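import Summits.BirchSwinnertonDyer.BirchSwinnertonDyer.Theorems.GenusKolyvaginAtTwoShaCardDvdPowAtTwoRTShaAnnihilation
import Summits.BirchSwinnertonDyer.BirchSwinnertonDyer.Theorems.GenusKolyvaginAtTwoShaCardDvdPowAtTwoRTKolyvaginDescentAtTransposition
import Summits.BirchSwinnertonDyer.BirchSwinnertonDyer.Theorems.GenusKolyvaginAtTwoEquivariantKolyvaginExactAtTwoVisiblePairFields
import Summits.BirchSwinnertonDyer.BirchSwinnertonDyer.Theorems.GenusKolyvaginAtTwoEquivariantKolyvaginExactAtTwoArchimedeanSelmerLevel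
import Summits.BirchSwinnertonDyer.BirchSwinnertonDyer.Theorems.GenusKolyvaginAtTwoEquivariantKolyvaginExactAtTwoKolyvaginPrimeDictionary
import Summits.BirchSwinnertonDyer.BirchSwinnertonDyer.Theorems.CMKolyvaginAtInertTwoCebotarevBinderPairDeeperAtTwo
import Summits.BirchSwinnertonDyer.BirchSwinnertonDyer.Theorems.CMKolyvaginAtInertTwoPairAssemblyCanonicalAtTwo
import HarnessLib

/-!
# Route `GenusKolyvaginAtTwo`, crux U_T `ShaCardDvdPowAtTwoRT` (stmt-BirchSwinnertonDyer-23658), LINE 19 `rational_pair_descent`,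
# sub-input (B2Q) of stub PAIRCOUNT — KOLYVAGIN'S THEOREM B₂ AT `l = 2` OVER `ℚ` ON THE HABITAT, SHARP:
# `2^{M₀} · Sel_(2^M)(E/ℚ) = 0` for every level `M`, hence `2^{M₀} · Ш(E/ℚ)[2^∞] = 0`

Seat `bsd-line-gk2-p4` g22 (WIDTH-5 attach, cell `bsd-f1-sign2`), `--supports stmt-BirchSwinnertonDyer-23658 --as helper`.
THEOREMS ONLY (no definition, no named fact, no `sorry`).  BSD is NOT proved by any of this; neither is U_T nor PAIRCOUNT (which needs in
addition (RANKQ) `#Ш(E/ℚ)[2] ≤ 4` and (CTQ), gk2-p5 g29).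

WHAT.  On U_T's frame (`E/ℚ` globally minimal, non-CM, odd Tamagawa product, an odd prime of multiplicative reduction, `Δ < 0`, `ρ_{E,2^n}`
onto; `K` imaginary quadratic, `d_K` odd `≠ −3`, Heegner, `d_K·(−|Δ|)`, `d_K·(−2|Δ|)` non-squares; a frame `(Dt, β, ι)`, a conductor-`1` datum
`d₁` with `2^{M₀+1} ∤ P(1)` in `E(K[1])`; Q2 `KolyvaginRelationAtTwo` by name) TOGETHER WITH `w(E) = +1` (LINE 19 v1.1's live configuration):
**for every `M` and every `s ∈ Sel_(2^M)(E/ℚ)`: `2^{M₀} • s = 0`** (`two_pow_smul_selmer_rat_eq_zero_onHabitat`).  This is the SHARP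
exponent: my predecessor g21's law (B) (`…RTRankDescentLaws.addOrderOf_mul_addOrderOf_dvd_of_sign_rootNumber`, over `K`) gives `2^{M₀+1}`;
the lost bit of the `K_λ`-duality is recovered by running the last step OVER `ℚ`:
1. `res s ∈ Sel_(2^M)(E/K)` is a `τ`-invariant class of the same order `2^a` (`res` injective, `E(K)[2] = 0`); `y = c_M(1) = δ y_K` has order
   `2^κ`, `κ ≥ M − M₀`, sign `−w = −1`;
2. Čebotarev ONE LEVEL UP (margin one): gk2-p2's full-order pair theorem `infinite_kolyvaginPrime_localization_fullOrder_pair` at level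
   `2^{M+1}` for `(ι_* res s, ι_* y)` (separation = (NPh_{M+1}) at the multiplicative prime, both classes Selmer) gives a Kolyvagin prime `ℓ`
   of index `≥ M+1` with `Frob ℓ = Frob ∞` on `E[2^{M+1}]` at which both have FULL local order; the orders transfer back to level `2^M`
   because `Γ_{K_λ}` fixes `E[2^{M+1}]` (`mem_torsionLocalKer_iff_torsionH1OfDvd_mem`);
3. the `τ`-INVARIANT Kolyvagin class `c_M(ℓ)` (sign `+w`; Gross 5.4 at `2`) DESCENDS to `u ∈ H¹(ℚ, E[2^M])`, Selmer at every finite `v ≠ ℓ`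
   (gk2-p3 g25 TQ-DEEP `exists_descent_kolyvaginClass_two_mem_selmerLocalKer_of_margin`: margin one pays the transposition primes) and at
   `∞` (`Δ < 0`); its Selmer threshold at `ℓ` is `κ` (Q2 at `λ` + the `ℚ_ℓ ↔ K_λ` transfer `zsmul_mem_selmerLocalKer_iff_resTorsion`);
4. gk2-p3 g12's UNCONDITIONAL `ℚ_ℓ`-duality `lemma_5_3_rat_two` (McCallum 5.3 + 2.2 by counting, Poitou–Tate inside, NO lost bit) for `(s, u)`:
   `2^{M−κ} • s_ℓ = 0`; with `s` of full local order (dictionary `zsmul_mem_torsionLocalKer_iff_resTorsion_of_notMem`): `a ≤ M − κ ≤ M₀`.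

References: [Kolyvagin1989Izv] Thm. B₂, §3; [McCallumLMS1991] §3 Cor. 3.2, §4 Prop. 4.4, Lemma 4.6, §5 Lemma 5.3; [GrossLMS1991] Props. 5.4, 6.2,
8.2, §10; [MilneADT2006] I Thm. 4.10, Cor. 3.4.
-/

set_option autoImplicit false
-- the Theorems namespace of this sub repeats the summit name by design (D-0017 nested layout)
set_option linter.dupNamespace false

noncomputable section

open scoped Classical
open scoped AddSubgroup

namespace Summit.BirchSwinnertonDyer.BirchSwinnertonDyer.Theorems.GenusExact.PlusDescent

open WeierstrassCurve NumberField IsDedekindDomain Field Rat.HeightOneSpectrum Literature.NumberTheory.EllipticCurves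
  Literature.NumberTheory.GaloisRepresentations Literature.NumberTheory.EllipticCurves.ModularForms AddSubgroup
  Literature.NumberTheory.EllipticCurves.RingClassField
open Summit.BirchSwinnertonDyer.BirchSwinnertonDyer.Theses.GenusKolyvaginAtTwo (KolyvaginRelationAtTwo)
open Summit.BirchSwinnertonDyer.Rank1Residual
open Summit.BirchSwinnertonDyer.BirchSwinnertonDyer.Theorems.GenusExact
open Summit.BirchSwinnertonDyer.BirchSwinnertonDyer.Theorems.GenusExact.VisiblePairAtTwo
  (kolPrime local_data liesOver_of_natCast_mem natCast_mem_primesEquiv_symm natCast_prime_mem_iff_eq hasGoodReductionAt_of_hasGoodReductionAtPrime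
    not_mem_range)

/-- **(B2Q) Kolyvagin's Theorem B₂ at `l = 2` over `ℚ` on U_T's habitat, SHARP: `2^{M₀} • s = 0` for every `s ∈ Sel_(2^M)(E/ℚ)`,
every `M`** (modulo Q2; `w(E) = +1`).  See the module docstring for the frame and the four steps.
[cite: Kolyvagin1989Izv, Thm. B₂, §3] [cite: McCallumLMS1991, §3 Cor. 3.2, §4 Prop. 4.4, §5 Lemma 5.3] [cite: GrossLMS1991, §10, Props. 5.4, 6.2, 8.2] -/
theorem two_pow_smul_selmer_rat_eq_zero_onHabitat (hQ2 : KolyvaginRelationAtTwo)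
    (W : WeierstrassCurve ℚ) [W.IsElliptic] [W.IsGloballyMinimal] [NeZero (W.conductorNorm ℤ)] (hcm : ¬ W.HasCM)
    (hT : Odd W.tamagawaProduct) (v : HeightOneSpectrum (𝓞 ℚ)) (h2v : ((2 : ℕ) : 𝓞 ℚ) ∉ v.asIdeal)
    (hNv : ((W.conductorNorm ℤ : ℕ) : 𝓞 ℚ) ∈ v.asIdeal) (hmult : W.HasMultiplicativeReductionAt v) (hneg : W.Δ < 0)
    (K : Type) [Field K] [NumberField K] (hIQ : IsImaginaryQuadratic K) (hodd : Odd (NumberField.discr K))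
    (h3 : NumberField.discr K ≠ -3) (hHe : SatisfiesHeegnerHypothesis (W.conductorNorm ℤ) K)
    (hsq1 : ¬ IsSquare ((NumberField.discr K : ℚ) * -|W.Δ|)) (hsq2 : ¬ IsSquare ((NumberField.discr K : ℚ) * (-(2 * |W.Δ|))))
    (hρ : ∀ n : ℕ, 0 < n → W.HasSurjectiveModNGaloisRep ((2 : ℤ) ^ n))
    (Dt : ModularParametrizationData W (W.conductorNorm ℤ)) (β : ℤ) (ι : K →+* ℂ) (d₁ : KolyvaginHeegnerData Dt β ι 1) (M₀ : ℕ)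
    (hndiv : ¬ ∃ Q : (W.baseChange (ringClassField K ι 1)).toAffine.Point, ((2 ^ (M₀ + 1) : ℕ) : ℤ) • Q = d₁.derivedPoint)
    (hw1 : W.rootNumber = 1)
    (M : ℕ) (s₀ : galH1Torsion W ((2 ^ M : ℕ) : ℤ)) (hs₀ : s₀ ∈ selmerGroup W ((2 ^ M : ℕ) : ℤ)) :
    ((2 ^ M₀ : ℕ) : ℤ) • s₀ = 0 := by
  haveI : Fact (Nat.Prime 2) := ⟨Nat.prime_two⟩
  haveI : ∀ j : ℕ, NumberField (ringClassField K ι j) := JET.numberField_ringClassField K hIQ ι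
  haveI hell : (W.baseChange K).IsElliptic := inferInstanceAs ((W.map (algebraMap ℚ K)).IsElliptic)
  -- ### the trivial range `M ≤ M₀`
  by_cases hMM₀ : M ≤ M₀
  · obtain ⟨e, he⟩ := Nat.exists_eq_add_of_le hMM₀
    have h0 : ((2 ^ M : ℕ) : ℤ) • s₀ = 0 := zsmul_discreteH1_torsion _ s₀
    have hpow : ((2 ^ M₀ : ℕ) : ℤ) = ((2 ^ e : ℕ) : ℤ) * ((2 ^ M : ℕ) : ℤ) := by
      rw [he, pow_add]; push_cast; ring
    rw [hpow, mul_smul, h0, zsmul_zero]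
  have hM₀M : M₀ + 1 ≤ M := by omega
  have hM : 1 ≤ M := le_trans (Nat.le_add_left 1 M₀) hM₀M
  have hM' : 1 ≤ M + 1 := by omega
  -- ### numerics and currencies
  have hsurN : ∀ m : ℕ, W.HasSurjectiveModNGaloisRep ((2 ^ m : ℕ) : ℤ) :=
    MinimalTwinBSDTwo.forall_hasSurjectiveModNGaloisRep_two_pow_of_pos W hρ
  have hρN : ∀ m : ℕ, W.HasSurjectiveModNGaloisRep (2 ^ m : ℕ) := fun m ↦ by exact_mod_cast hsurN m
  have hsurj1 : W.HasSurjectiveModNGaloisRep ((2 : ℤ) ^ 1) := hρ 1 one_pos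
  have hs2 : W.HasSurjectiveModNGaloisRep 2 := by simpa using hsurj1
  have h2 : Module.finrank ℚ K = 2 := hIQ.1
  have hN : (W.conductorNorm ℤ) ≠ 0 := NeZero.ne _
  have hD4 : NumberField.discr K ≠ -4 := fun h ↦ by
    rw [h] at hodd; exact (Int.not_even_iff_odd.mpr hodd) ⟨-2, by norm_num⟩
  have hD : NumberField.discr K < -4 := X11b.KolyvaginAssembly.discr_lt_neg_four hIQ ⟨h3, hD4⟩
  -- the complex conjugation `τ = σ_θ`, `θ² = d_K`
  obtain ⟨θ, hθ, hd⟩ := Literature.NumberTheory.QuadraticFields.Quadratic.exists_not_mem_range_sq_eq_discr (K := K) h2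
  set τ : K ≃ₐ[ℚ] K := sigmaQ K h2 hθ hd with hτdef
  have hτ : τ ≠ 1 := sigmaQ_ne_one K h2 hθ hd
  -- ### no `2`-power torsion in `E(K)`
  have htorsK : ∀ (m : ℕ) (P : (W.baseChange K).toAffine.Point), ((2 ^ m : ℕ) : ℤ) • P = 0 → P = 0 := fun m P hP ↦
    EigenClassesFinite.forall_zsmul_two_pow_baseChange_eq_zero_of_hasSurjectiveModNGaloisRep_two W K h2 hs2 m P
      (by exact_mod_cast hP)
  -- ### (NPh) at levels `M` and `M + 1` from the multiplicative prime
  have hNPh : ∀ (L : ℕ), 1 ≤ L → ∀ z : galH1Torsion (W.baseChange K) ((2 ^ L : ℕ) : ℤ),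
      (∀ ρ' ∈ torsionFixing (W.baseChange K) ((2 ^ L : ℕ) : ℤ), h1Eval (W.baseChange K) ((2 ^ L : ℕ) : ℤ) z ρ' = 0) →
      (∀ w : HeightOneSpectrum (𝓞 K), z ∈ selmerLocalKer (W.baseChange K) (w.adicCompletion K) ((2 ^ L : ℕ) : ℤ)) → z = 0 :=
    fun L hL z hz hzS ↦ NonPhantomPow.nonPhantomAtTwo_of_hasMultiplicativeReductionAt (W := W) (K := K) hT hρ hIQ hodd hsq1 hsq2 hN hHe
      h2v hNv hmult L hL z hz (fun w _ ↦ hzS w)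
  -- ### the Selmer class over `K`: `s = res s₀`, `τ`-invariant, same order `2^a`
  set s := resTorsion W K ((2 ^ M : ℕ) : ℤ) s₀ with hsdef
  have hsSel : s ∈ selmerGroup (W.baseChange K) ((2 ^ M : ℕ) : ℤ) := resTorsion_mem_selmerGroup W K ((2 ^ M : ℕ) : ℤ) hs₀
  have hinjres : Function.Injective (resTorsion W K ((2 ^ M : ℕ) : ℤ)) :=
    EigenClassesFinite.resTorsion_injective_of_noTorsion W K h2 hθ hd ((2 ^ M : ℕ) : ℤ) (htorsK M)
  have hτs : conjAct W τ ((2 ^ M : ℕ) : ℤ) s = s :=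
    (EigenClassesFinite.mem_range_resTorsion_iff_conjAct_eq W K h2 hθ hd ((2 ^ M : ℕ) : ℤ) (htorsK M) s).mp ⟨s₀, rfl⟩
  obtain ⟨a, haM, ha⟩ := exists_addOrderOf_galH1Torsion_eq_two_pow W K M s
  by_cases ha0 : a = 0
  · -- `s = 0`, hence `s₀ = 0`
    have hs0 : s = 0 := AddMonoid.addOrderOf_eq_one_iff.mp (by rw [ha, ha0, pow_zero])
    have : s₀ = 0 := hinjres (by rw [← hsdef, hs0, map_zero])
    rw [this, zsmul_zero]
  have ha1 : 1 ≤ a := Nat.one_le_iff_ne_zero.mpr ha0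
  -- ### the Heegner class `y = c_M(1) = δ Ph`, order `2^κ`, `κ ≥ M − M₀`, sign `−1`
  have hdiv : ∀ P : geomPoints (W.baseChange K), ∃ Q : geomPoints (W.baseChange K), ((2 ^ M : ℕ) : ℤ) • Q = P :=
    (W.baseChange K).zsmul_geomPoints_surjective_of_charZero (by positivity)
  set δ := kummerMapTorsion (W.baseChange K) ((2 ^ M : ℕ) : ℤ) hdiv with hδ
  have hker : δ.ker = (zsmulAddGroupHom (α := (W.baseChange K).toAffine.Point) ((2 ^ M : ℕ) : ℤ)).range := kummerMapTorsion_ker (W.baseChange K) ((2 ^ M : ℕ) : ℤ) hdiv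
  obtain ⟨Ph, hPh, hPhmap⟩ := AdditiveKoly.exists_isHeegnerPoint_map_eq_derivedPoint_one (W := W) (K := K) (Dt := Dt) (β := β)
    (ι := ι) hIQ hHe d₁
  set y := d₁.kolyvaginClass Nat.prime_two M with hydef
  have hc1 : y = δ Ph := VisiblePairAtTwo.kolyvaginClass_one_two_eq_kummerMapTorsion W K hIQ hodd hHe hsurj1 M d₁ Ph hPhmap
  have hP₀ : ∀ Q : (W.baseChange K).toAffine.Point, ((2 ^ (M₀ + 1) : ℕ) : ℤ) • Q ≠ Ph :=
    forall_two_pow_smul_ne_bottom_of_not_dvd_derivedPoint d₁ Ph hPhmap le_rfl hndiv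
  obtain ⟨κ, hκM, hκ⟩ := exists_addOrderOf_galH1Torsion_eq_two_pow W K M y
  have hκge : M - M₀ ≤ κ := by
    by_contra hlt'
    have h0 : ((2 ^ κ : ℕ) : ℤ) • y = 0 := (two_pow_zsmul_eq_zero_iff_of_addOrderOf W K hκ κ).mpr le_rfl
    have hmem : ((2 ^ κ : ℕ) : ℤ) • Ph ∈ δ.ker := by rw [AddMonoidHom.mem_ker, map_zsmul, ← hc1, h0]
    rw [hker] at hmem
    obtain ⟨R, hR⟩ := hmem
    have hPhR : Ph = ((2 ^ (M - κ) : ℕ) : ℤ) • R := eq_two_pow_zsmul_of_two_pow_zsmul_eq (htorsK 1 · <| by simpa using ·) hκM hR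
    refine hP₀ (((2 ^ (M - κ - (M₀ + 1)) : ℕ) : ℤ) • R) ?_
    rw [hPhR, smul_smul]
    congr 1
    push_cast
    rw [← pow_add]
    congr 1
    omega
  have hκ1 : 1 ≤ κ := by omega
  have h1K : ∀ q ∈ (1 : ℕ).primeFactors, Zhang2014.IsKolyvaginPrime (W.conductorNorm ℤ) W K 2 q ∧ M ≤ Zhang2014.kolyvaginIndex W 2 q := by
    simp
  have h1K' : ∀ q ∈ (1 : ℕ).primeFactors, Zhang2014.IsKolyvaginPrime (W.conductorNorm ℤ) W K 2 q ∧
      M + 1 ≤ Zhang2014.kolyvaginIndex W 2 q := by simp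
  obtain ⟨-, hτy⟩ := KolyvaginClassSign.sign_conjAct_kolyvaginClass_two hIQ h3 hD4 hodd hHe hsurj1 τ hτ Dt β ι squarefree_one hM h1K d₁
  rw [Nat.primeFactors_one, Finset.card_empty, pow_zero, mul_one, hw1] at hτy
  -- ### ONE LEVEL UP: `ι_* s`, `ι_* y` at level `2^(M+1)`
  have hdvd : ((2 ^ M : ℕ) : ℤ) ∣ ((2 ^ (M + 1) : ℕ) : ℤ) := KolyvaginPairDataTwo.two_pow_dvd_two_pow_succ M
  set ιM := torsionH1OfDvd (W.baseChange K) hdvd with hιM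
  have hιinj : Function.Injective ιM := KolyvaginPairDataTwo.torsionH1OfDvd_succ_injective W M hIQ hs2
  have hsSel' : ιM s ∈ selmerGroup (W.baseChange K) ((2 ^ (M + 1) : ℕ) : ℤ) := torsionH1OfDvd_mem_selmerGroup (W.baseChange K) hdvd hsSel
  have hySel : y ∈ selmerGroup (W.baseChange K) ((2 ^ M : ℕ) : ℤ) := by
    rw [hc1]; exact WeierstrassCurve.kummerMapTorsion_mem_selmerGroup (W.baseChange K) _ hdiv Ph
  have hySel' : ιM y ∈ selmerGroup (W.baseChange K) ((2 ^ (M + 1) : ℕ) : ℤ) := torsionH1OfDvd_mem_selmerGroup (W.baseChange K) hdvd hySel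
  have hords' : addOrderOf (ιM s) = 2 ^ a := by rw [addOrderOf_injective ιM hιinj, ha]
  have hordy' : addOrderOf (ιM y) = 2 ^ κ := by rw [addOrderOf_injective ιM hιinj, hκ]
  have hτs' : conjAct W τ ((2 ^ (M + 1) : ℕ) : ℤ) (ιM s) = (1 : ℤ) • ιM s := by
    rw [one_zsmul, hιM, conjAct_torsionH1OfDvd W τ hdvd s, hτs]
  have hτy' : conjAct W τ ((2 ^ (M + 1) : ℕ) : ℤ) (ιM y) = (-1 : ℤ) • ιM y := by
    rw [hιM, conjAct_torsionH1OfDvd W τ hdvd y, hτy, map_zsmul]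
  -- separation for the pair from (NPh_{M+1}): both classes are Selmer
  have hres : ∀ a' b' : ℤ, (∀ ρ' ∈ torsionFixing (W.baseChange K) ((2 ^ (M + 1) : ℕ) : ℤ), h1Eval (W.baseChange K) ((2 ^ (M + 1) : ℕ) : ℤ) (a' • ιM s + b' • ιM y) ρ' = 0) →
      a' • ιM s + b' • ιM y = 0 := by
    intro a' b' hab
    have hmem : a' • ιM s + b' • ιM y ∈ selmerGroup (W.baseChange K) ((2 ^ (M + 1) : ℕ) : ℤ) :=
      add_mem (AddSubgroup.zsmul_mem _ hsSel' a') (AddSubgroup.zsmul_mem _ hySel' b')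
    exact hNPh (M + 1) hM' _ hab (fun w ↦ (((W.baseChange K).mem_selmerGroup_iff _ _).mp hmem).1 w)
  -- ### the Kolyvagin prime (gk2-p2's full-order pair Čebotarev at level `2^(M+1)`)
  have hinf := infinite_kolyvaginPrime_localization_fullOrder_pair (W.conductorNorm ℤ) W hcm hneg K hIQ hsq1 hρN τ hτ (M + 1) hM'
    (ιM s) (ιM y) ha1 hκ1 hords' hordy' (Or.inl rfl) (Or.inr rfl) hτs' hτy' hres
  obtain ⟨ℓ, hℓmem⟩ := hinf.nonempty
  obtain ⟨hF', hkolZ, hidx', hloc'⟩ := hℓmem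
  obtain ⟨hℓp, hℓN, hℓdK, hℓ2, hℓprime, hidxpos⟩ := hkolZ
  haveI : Fact ℓ.Prime := ⟨hℓp⟩
  have hF : FrobEqFrobInfty W K (2 ^ M) ℓ := FrobEqFrobInfty.of_dvd (pow_dvd_pow 2 (Nat.le_succ M)) hF'
  have hF2 : FrobEqFrobInfty W K 2 ℓ := FrobEqFrobInfty.of_dvd (dvd_pow_self 2 (Nat.succ_ne_zero M)) hF'
  -- Gross's form of the Kolyvagin prime and its place `λ`
  have hkolG : Literature.NumberTheory.EllipticCurves.IsKolyvaginPrime (W.conductorNorm ℤ) W K 2 ℓ :=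
    ⟨hℓp, hℓN, hℓdK, hℓ2, hℓprime, hF2⟩
  have hkolZ : Zhang2014.IsKolyvaginPrime (W.conductorNorm ℤ) W K 2 ℓ := ⟨hℓp, hℓN, hℓdK, hℓ2, hℓprime, hidxpos⟩
  have hkol : kolPrime W K M ℓ := KolyvaginPairDataTwo.kolPrime_of_isKolyvaginPrime_of_frobEqFrobInfty_succ (W := W) (K := K) h2 hM hkolG hF'
  set w : HeightOneSpectrum (𝓞 K) := hkolG.place with hwdef
  have hwℓ : (ℓ : 𝓞 K) ∈ w.asIdeal := hkolG.mem_place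
  set vℓ : HeightOneSpectrum (𝓞 ℚ) := primesEquiv.symm ⟨ℓ, hℓp⟩ with hvℓdef
  obtain ⟨_, hℓv, h2vℓ, hqv, hdKv⟩ := local_data hkol
  haveI hLO : w.asIdeal.LiesOver vℓ.asIdeal := liesOver_of_natCast_mem hℓp hℓv hwℓ
  obtain ⟨_hℓ', _hℓ2', _hℓd', hgood, _hFq, _hF2', _hMi, hinert⟩ := id hkol
  have hgoodv : W.HasGoodReductionAt vℓ := hasGoodReductionAt_of_hasGoodReductionAtPrime W hgood hℓv
  -- ### full local orders at `λ`, transferred back to level `2^M` (`Γ_{K_λ}` fixes `E[2^(M+1)]`)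
  obtain ⟨hαs', hαy'⟩ := hloc' w hwℓ
  have htriv : ∀ (g : absoluteGaloisGroup (hkolG.place.adicCompletion K)) (Q : geomTorsion (W.baseChange K) ((2 ^ (M + 1) : ℕ) : ℤ)),
      resGal (K := K) (hkolG.place.adicCompletion K) g • Q = Q := fun g Q ↦
    absGaloisRestrict_smul_geomTorsion_eq_of_kolyvaginPrime_pow W hIQ hPh Nat.prime_two hkolG (M + 1) hF' g Q
  have htrans : ∀ x : galH1Torsion (W.baseChange K) ((2 ^ M : ℕ) : ℤ), x ∈ (W.baseChange K).torsionLocalKer (w.adicCompletion K) ((2 ^ M : ℕ) : ℤ) ↔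
      ιM x ∈ (W.baseChange K).torsionLocalKer (w.adicCompletion K) ((2 ^ (M + 1) : ℕ) : ℤ) := fun x ↦
    mem_torsionLocalKer_iff_torsionH1OfDvd_mem (W.baseChange K) (w.adicCompletion K) (pow_dvd_pow 2 (Nat.le_succ M))
      (pow_ne_zero _ two_ne_zero) (pow_ne_zero _ two_ne_zero) htriv x
  have hαs : ∀ j : ℕ, ((2 ^ j : ℕ) : ℤ) • s ∈ (W.baseChange K).torsionLocalKer (w.adicCompletion K) ((2 ^ M : ℕ) : ℤ) ↔ a ≤ j := fun j ↦ by
    rw [htrans, map_zsmul]; exact hαs' j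
  have hαy : ∀ j : ℕ, ((2 ^ j : ℕ) : ℤ) • y ∈ (W.baseChange K).torsionLocalKer (w.adicCompletion K) ((2 ^ M : ℕ) : ℤ) ↔ κ ≤ j := fun j ↦ by
    rw [htrans, map_zsmul]; exact hαy' j
  -- ### the datum at conductor `ℓ` compatible with `d₁`, its class `x = c_M(ℓ)` (sign `+1`) and Q2 at `λ`
  obtain ⟨dℓ, hdℓ⟩ := JET.exists_compatible_data_of_grossCM
    (phi_heegnerPointOfConductor_mem_range_map_ringClassField_holds (W.conductorNorm ℤ) W K) hIQ hD hHe 2 Dt β ι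
    squarefree_one (by simp) d₁
  have hℓ1 : ℓ ∉ (1 : ℕ).primeFactors := by simp
  obtain ⟨hσ', hS', hS'', hemb'⟩ := hdℓ ℓ hkolZ hℓ1
  set d' := dℓ ℓ hkolZ hℓ1 with hd'_def
  set x := d'.kolyvaginClass Nat.prime_two M with hx_def
  have hc' : Squarefree (1 * ℓ) := by rw [one_mul]; exact hℓp.squarefree
  have hℓn : ¬ ℓ ∣ 1 := fun h ↦ hℓp.one_lt.ne' (Nat.dvd_one.mp h)
  have hkM : ∀ q ∈ (1 * ℓ).primeFactors, Zhang2014.IsKolyvaginPrime (W.conductorNorm ℤ) W K 2 q ∧ M ≤ Zhang2014.kolyvaginIndex W 2 q := by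
    intro q hq
    rw [one_mul, hℓp.primeFactors, Finset.mem_singleton] at hq
    subst hq
    exact ⟨hkolZ, le_trans (Nat.le_succ M) hidx'⟩
  have hkM1 : ∀ q ∈ (1 * ℓ).primeFactors, Zhang2014.IsKolyvaginPrime (W.conductorNorm ℤ) W K 2 q ∧
      M + 1 ≤ Zhang2014.kolyvaginIndex W 2 q := by
    intro q hq
    rw [one_mul, hℓp.primeFactors, Finset.mem_singleton] at hq
    subst hq
    exact ⟨hkolZ, hidx'⟩
  have hcard : (1 * ℓ).primeFactors.card = 1 := by rw [one_mul, hℓp.primeFactors, Finset.card_singleton]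
  -- signs: `c_M(ℓ)`, `c_{M+1}(ℓ)` are `τ`-invariant (`−w·(−1) = +1`)
  obtain ⟨-, hx⟩ := KolyvaginClassSign.sign_conjAct_kolyvaginClass_two hIQ h3 hD4 hodd hHe hsurj1 τ hτ Dt β ι hc' hM hkM d'
  obtain ⟨-, hx1⟩ := KolyvaginClassSign.sign_conjAct_kolyvaginClass_two hIQ h3 hD4 hodd hHe hsurj1 τ hτ Dt β ι hc' hM' hkM1 d'
  rw [hcard, pow_one, hw1] at hx hx1
  norm_num at hx hx1
  -- Q2 at the own prime: Selmer threshold of `x` at `λ` = zero threshold `κ` of `y`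
  have hQ := hQ2 W hcm K hIQ h3 hD4 hHe hρN Dt β ι M hM 1 ℓ hc' hℓp hℓn hkM d₁ d' hσ' hS' hS'' hemb' w hwℓ
  have hβ : ∀ j : ℕ, ((2 ^ j : ℕ) : ℤ) • x ∈ selmerLocalKer (W.baseChange K) (w.adicCompletion K) ((2 ^ M : ℕ) : ℤ) ↔ κ ≤ j :=
    fun j ↦ (hQ j).1.trans (((hQ j).2).trans (hαy j))
  -- ### the ℚ-descent `u` of `x` (TQ-DEEP, margin one): Selmer at every finite `v' ≠ v_ℓ` and at `∞`
  obtain ⟨u, hu, -⟩ := EigenClassesFinite.existsUnique_resTorsion_eq_of_conjAct_eq W K h2 hθ hd ((2 ^ M : ℕ) : ℤ) (htorsK M) hx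
  have hufin : ∀ v' : HeightOneSpectrum (𝓞 ℚ), v' ≠ vℓ → u ∈ selmerLocalKer W (v'.adicCompletion ℚ) ((2 ^ M : ℕ) : ℤ) := by
    intro v' hv'
    have hv'' : ∀ w' : HeightOneSpectrum (𝓞 K), w'.asIdeal.LiesOver v'.asIdeal → ((1 * ℓ : ℕ) : 𝓞 K) ∉ w'.asIdeal := by
      intro w' hw' hmem
      rw [one_mul] at hmem
      have hvmem : (ℓ : 𝓞 ℚ) ∈ v'.asIdeal := by
        have h : algebraMap (𝓞 ℚ) (𝓞 K) (ℓ : 𝓞 ℚ) ∈ w'.asIdeal := by rwa [map_natCast]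
        rw [← Ideal.mem_comap, ← Ideal.under_def, ← Ideal.LiesOver.over (P := w'.asIdeal) (p := v'.asIdeal)] at h
        exact h
      exact hv' ((natCast_prime_mem_iff_eq hℓp v').mp hvmem)
    obtain ⟨u', hu', hsel⟩ := SelmerDescent.exists_descent_kolyvaginClass_two_mem_selmerLocalKer_of_margin W hsurN hT K hIQ h2 hθ hd h3
      hD4 hHe Dt β ι M hc' hkM1 d' (htorsK (M + 1)) hx1 hx v' hv''
    have huu : u' = u := hinjres (hu'.trans hu.symm)
    rw [← huu]
    exact hsel
  have huinf : ∀ w' : InfinitePlace ℚ, u ∈ selmerLocalKer W w'.Completion ((2 ^ M : ℕ) : ℤ) := fun w' ↦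
    ArchVanishing.mem_selmerLocalKer_infinitePlace_of_Δ_neg W w' hneg ((2 ^ M : ℕ) : ℤ) u
  -- the Selmer threshold of `u` at `v_ℓ` is `κ`: `2^(κ−1) • u` is NOT Selmer there
  have hudv : ((2 : ℤ) ^ (κ - 1)) • u ∉ selmerLocalKer W (vℓ.adicCompletion ℚ) ((2 ^ M : ℕ) : ℤ) := by
    intro hmem
    have h' : ((2 : ℤ) ^ (κ - 1)) • resTorsion W K ((2 ^ M : ℕ) : ℤ) u ∈ selmerLocalKer (W.baseChange K) (w.adicCompletion K) ((2 ^ M : ℕ) : ℤ) :=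
      (SelmerDescent.zsmul_mem_selmerLocalKer_iff_resTorsion W h2 (not_mem_range hθ) hd ((2 ^ M : ℕ) : ℤ) vℓ w hgoodv hqv h2vℓ hdKv u _).mp hmem
    rw [hu] at h'
    have h'' : ((2 ^ (κ - 1) : ℕ) : ℤ) • x ∈ selmerLocalKer (W.baseChange K) (w.adicCompletion K) ((2 ^ M : ℕ) : ℤ) := by exact_mod_cast h'
    have := (hβ (κ - 1)).mp h''
    omega
  -- ### McCallum 5.3 + 2.2 over `ℚ_ℓ` (no lost bit): `2^(M − κ) • s₀` vanishes at `v_ℓ`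
  have hdual := FrobeniusCriterion.lemma_5_3_rat_two W hneg hM (q := 2 ^ M) rfl hℓ2 hℓv hgood hF2 (le_trans (Nat.le_succ M) hidx') hs₀
    hufin huinf hudv
  have hexp : M - 1 - (κ - 1) = M - κ := by omega
  rw [hexp] at hdual
  -- transfer to `K_λ`
  have hdualK : ((2 : ℤ) ^ (M - κ)) • s ∈ (W.baseChange K).torsionLocalKer (w.adicCompletion K) ((2 ^ M : ℕ) : ℤ) := by
    have h := (SelmerDescent.zsmul_mem_torsionLocalKer_iff_resTorsion_of_notMem W hneg hM (q := 2 ^ M) rfl hℓp hℓ2 hℓv hgoodv h2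
      (not_mem_range hθ) hd hdKv hF w (hinert w hwℓ) s₀ ((2 : ℤ) ^ (M - κ))).mp hdual
    exact h
  have hdualK' : ((2 ^ (M - κ) : ℕ) : ℤ) • s ∈ (W.baseChange K).torsionLocalKer (w.adicCompletion K) ((2 ^ M : ℕ) : ℤ) := by exact_mod_cast hdualK
  -- ### conclusion: `a ≤ M − κ ≤ M₀`
  have haMκ : a ≤ M - κ := (hαs (M - κ)).mp hdualK'
  have haM₀ : a ≤ M₀ := by omega
  have hs0 : ((2 ^ M₀ : ℕ) : ℤ) • s = 0 := (two_pow_zsmul_eq_zero_iff_of_addOrderOf W K ha M₀).mpr haM₀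
  apply hinjres
  rw [map_zsmul, map_zero, ← hsdef, hs0]

/-- **Corollary: `2^{M₀} · Ш(E/ℚ)[2^∞] = 0` on U_T's habitat with `w(E) = +1`** — every class of `Ш(E/ℚ)` killed by a power of `2`
is killed by `2^{M₀}` (`Sel_(2^k)(E/ℚ) ↠ Ш(E/ℚ)[2^k]`, Silverman X.4.2(a) = tree `map_torsionH1ToH1_selmerGroup_holds`, and the sharp
exponent `two_pow_smul_selmer_rat_eq_zero_onHabitat`).  This is the input (B2Q) of LINE 19's stub PAIRCOUNT (with (RANKQ) and (CTQ) it gives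
`#Ш(E/ℚ)[2^∞] ∣ 4^{M₀}`). [cite: Kolyvagin1989Izv, Thm. B₂] [cite: McCallumLMS1991, §1 Theorem] [cite: SilvermanAEC2009, Thm. X.4.2(a)] -/
theorem two_pow_M0_smul_eq_zero_of_mem_sha_rat_onHabitat (hQ2 : KolyvaginRelationAtTwo)
    (W : WeierstrassCurve ℚ) [W.IsElliptic] [W.IsGloballyMinimal] [NeZero (W.conductorNorm ℤ)] (hcm : ¬ W.HasCM)
    (hT : Odd W.tamagawaProduct) (v : HeightOneSpectrum (𝓞 ℚ)) (h2v : ((2 : ℕ) : 𝓞 ℚ) ∉ v.asIdeal)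
    (hNv : ((W.conductorNorm ℤ : ℕ) : 𝓞 ℚ) ∈ v.asIdeal) (hmult : W.HasMultiplicativeReductionAt v) (hneg : W.Δ < 0)
    (K : Type) [Field K] [NumberField K] (hIQ : IsImaginaryQuadratic K) (hodd : Odd (NumberField.discr K))
    (h3 : NumberField.discr K ≠ -3) (hHe : SatisfiesHeegnerHypothesis (W.conductorNorm ℤ) K)
    (hsq1 : ¬ IsSquare ((NumberField.discr K : ℚ) * -|W.Δ|)) (hsq2 : ¬ IsSquare ((NumberField.discr K : ℚ) * (-(2 * |W.Δ|))))
    (hρ : ∀ n : ℕ, 0 < n → W.HasSurjectiveModNGaloisRep ((2 : ℤ) ^ n))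
    (Dt : ModularParametrizationData W (W.conductorNorm ℤ)) (β : ℤ) (ι : K →+* ℂ) (d₁ : KolyvaginHeegnerData Dt β ι 1) (M₀ : ℕ)
    (hndiv : ¬ ∃ Q : (W.baseChange (ringClassField K ι 1)).toAffine.Point, ((2 ^ (M₀ + 1) : ℕ) : ℤ) • Q = d₁.derivedPoint)
    (hw1 : W.rootNumber = 1)
    (k : ℕ) (a : W.galH1) (ha : a ∈ W.sha) (hka : ((2 ^ k : ℕ) : ℤ) • a = 0) :
    ((2 ^ M₀ : ℕ) : ℤ) • a = 0 := by
  rcases Nat.eq_zero_or_pos k with rfl | hkpos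
  · rw [pow_zero, Nat.cast_one, one_zsmul] at hka
    rw [hka, zsmul_zero]
  · have hn : ((2 ^ k : ℕ) : ℤ) ≠ 0 := by positivity
    have hmem : a ∈ W.sha ⊓ torsionBy W.galH1 ((2 ^ k : ℕ) : ℤ) :=
      AddSubgroup.mem_inf.mpr ⟨ha, by change ((2 ^ k : ℕ) : ℤ) • a = 0; exact hka⟩
    rw [← WeierstrassCurve.map_torsionH1ToH1_selmerGroup_holds W hn] at hmem
    obtain ⟨x, hx, rfl⟩ := AddSubgroup.mem_map.mp hmem
    rw [← map_zsmul, two_pow_smul_selmer_rat_eq_zero_onHabitat hQ2 W hcm hT v h2v hNv hmult hneg K hIQ hodd h3 hHe hsq1 hsq2 hρ Dt β ι d₁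
      M₀ hndiv hw1 k x hx, map_zero]

end Summit.BirchSwinnertonDyer.BirchSwinnertonDyer.Theorems.GenusExact.PlusDescent

end
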